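import Summits.QuantumFields.YangMills.Theorems.BalabanUVNodesK1V6Defs
import Summits.QuantumFields.YangMills.Theorems.BalabanUVNodesK1BetaWindow13SOfNodes13PWSOfBoxH
import Summits.QuantumFields.YangMills.Theorems.StabilityBAtRecordR13SepCoPH.Negative.SignBoxAtEveryWitnessFalse
import Summits.QuantumFields.YangMills.Theorems.BalabanUVNodesN11Sect3SupplyChainNodeAtNumerics

/-!
# K1⁷ v6 — THE REGISTERED STUB 2″'s TEXT FROM «N11 CEILING-UNIFORM» (`N11CU`) AND «MATCH-FREE RUN ROWS» (`Stub2WF`), BY NAME over `K1V6Defs`; the N11-ONLY RAISE behind it; and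
# `N11CU`'s body ON N11's CHAIN ROAD from `∀ P, SupplyChainAt θ P` at any live re-pin ∕ K1's witness (kernel bookkeeping, def-free)

Cell `pub-ymgap`, WIDTH SEAT `pub-ymgap-dag-n11-w6` (g0; R399 (3a) second wave on NODE n11 [B14]; director-ym №197∕№207, HUMAN RULING D-0149∕D-0154).
`--kind proof --supports stmt-QuantumFields-20542 --as helper` (count-neutral).  [III] = [Balaban1988Convergent]; [V] = [Balaban1989LargeFieldII]; [I] = [Balaban1987RG1].

WHY (plan g83 WORDS-1b (C) l.29306 ∕ START-LIST v11 §1 header (iii): «the by-name split `stub2V6_of_n11CU_stub2WF : N11CU → Stub2WF → <stub 2 text>` lands INSIDE a `--supports 20542`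
file against the registered text (the mirror `K1V6Defs` p603819 makes it uniform)»; §n11 v11 l.175–176: item 1's K1-side consumer currency = `N11CU`, CONFIRMED by dag-n11-e g19 «`N11CU` AT LIVE
RE-PINS ⟸ `∀ P, SupplyChainAt θᴴ P`»; CRIT-1 g4 triage sheet `Cruxes/StabilityBAtRecordR13SepCoPH/CRIT-1-TRIAGE-k1-ceiling-before-world-ed2.md` recommendation (c)).  The REGISTERED v6 stub 2″ `stub_runRows13PWS : ∀ F, NodesAtSomeRecord13PWS F → RunRowsAtSomeRecord13PWS F` (plan g82, 03f66ac9cc89391f; tree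
mirror `K1V6Defs`, dag-n24-w1 p603819) asks, besides the MATCH-FREE run rows `b r γ₀ B M` of `β_θ`, the numeric match `B + r ≤ w.βup` at the OUTPUT world.  Its HYPOTHESIS is
CEILING-BLIND (§3: for every `c`, rung 1 ↔ rung 1 with `w.βup ≤ c`, by p602267's twin `withCeiling`), so every proof RE-WORLDS: it produces the thirteen nodes at a world whose
ceiling letter dominates `B + r`.  dag-n24-w1's ceiling-keyed bridge `K1RunRowsOfBoxAndPartialSums.runRowsText_of_ceilingKeyedRung1_of_rows` (p602861 §3) types that re-worlding as the
family `∀ c, ∃ w, c ≤ w.βup ∧ RecordS ∧ ∀ P, Nodes (leavesP w P)`.  THIS FILE shows that family costs EXACTLY ONE NODE: of the thirteen mains only N11 = `Dag.B14_main` reads the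
ceiling letter (through its antecedent `flowControl` = [III] (2.6) with `β′ := w.βup`), the other twelve are `βup`-free and antitone in `γ` (dag-n24-w1's `nodes_leavesP_reletter_of_le`,
BoxH §1).  Hence (§1) nodes at `w` + N11 at the re-lettered world `{w with βup := c, γ := γ'}` (`γ' ≤ w.γ`) ⟹ all thirteen nodes there; (§2) ONE rung-1 core datum
`(θ, h, w)` + «N11 at every ceiling letter `c`, window re-lettered to SOME `γ' ∈ ]0, w.γ]`» (= [III] Thm 1 p.262 with the constant `β′` of (2.6) p.255 a PARAMETER, print's own
quantifier order «with some positive constants β′, β₀ … if γ is sufficiently small», p.255 L28–31) ⟹ the ceiling-keyed family; (§2) + p602861 §3 ⟹ v6's rung-2″ text BY NAME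
from MATCH-FREE rows; (§2, skeleton level) `stub_runRows13PWS`'s text BY NAME from the two displayed suppliers «N11 ceiling-uniform at rung-1 core data» (nodes cell) and «match-free run
rows at SOME rung-1 core datum» (β cell) — CRIT-1's `stub2V6_of_n11CU_stub2WF`, typed over the tree's `K1V6Defs` names with both suppliers as def-free hypotheses.  §3: the
ceiling-blindness `iff` and the free DOWNWARD half (for `c ≤ w.βup` take `γ' := w.γ`; p602267 `nodes_leavesP_lowerβup`).  §4: `N11CU`'s BODY ON N11's CHAIN ROAD — at
any rung-1 core datum over an H-extension of a LIVE RE-PIN ∕ of K1's witness `θ₁₅ᶜᶜᴹᵂ(j; γ)`, `∀ c, ∃ γ' ≤ w.γ, ∀ P, Dag.B14_main (leavesP {w with βup := c, γ := γ'} P)` from N11's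
one-token residual `∀ P, SupplyChainAt θ P` (dag-n11-e g19 p606248 `b14_main_liveRepinH ∕ theta13OfThm1CCMWH_of_obligations`: the ceiling letter is never read; CONFIRM-(C) l.29464),
hence v6's rung-2″ text at such a datum from the chain + match-free rows.  COMPLEMENTARY, not overlapping: dag-n11-d g14's `…N11K1CeilingFreeOfSupplyChain` (INTENT l.29531) works at the
CONSEQUENT level (rung-1 datum + run letters + chain ⇒ the crux's consequent, p598782 §2∕§3 with `hmatch` deleted); this file works at the level of the REGISTERED TEXTS (`K1V6Defs`,
p602861 §3), so that a `stub_runRows13PWS` proof can be ASSEMBLED BY NAME from an `N11CU` supplier and a `Stub2WF` supplier (plan g83 (C)).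

HONEST FRAMING ∕ A6.  Pure propositional bookkeeping over the citation DAG's typed leaves; every N11 instance (`h14`, `hraise`, `hN11`) and every β-row (`hrows`, `hWF`) is a DISPLAYED
HYPOTHESIS, inhabited at no `θ` here; nothing of Bałaban's analysis is asserted or proved; no stub is closed; N11 is NOT discharged; K1⁷ is NOT closed; N24 stays COMPOSITE; counts
unmoved (typed 28∕28 · discharged 5∕27).  No summit statement is proved by this seat: `route-QuantumFields-BalabanUVNodes` closes ONLY the CONDITIONAL finite-𝕋⁴ rung
`BalabanLadder.UV` of one programme at fixed `ε = L^{−K}` — NOT ℝ⁴, NOT OS, NOT the Yang–Mills mass gap (Clay).  No `sorry`, `axiom`, `def`, `instance`, `notation`.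
-/

noncomputable section

namespace Summit.QuantumFields.YangMills.Theorems.BalabanUVNodesK1RunRowsTextOfN11CUOfRowsWF

open Literature.MathematicalPhysics.QuantumFieldTheory.Balaban1983to89
open Literature.MathematicalPhysics.QuantumFieldTheory.Balaban1983to89.Node00
open Literature.MathematicalPhysics.QuantumFieldTheory.Balaban1983to89.T4Continuum
open Literature.MathematicalPhysics.QuantumFieldTheory.Balaban1983to89.DagBinding
open T4DatumAssembly FlowStepRuns
open FlowStep (HBeta RGEqH prefixOf)
open Summit.QuantumFields.YangMills.Theorems.BalabanUVNodesK2NamedJetsRunRemAt (RunConstRemainder)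
open Summit.QuantumFields.YangMills.Theorems.K1V6Defs (RecordS NodesAtSomeRecord13PWS RunRowsAtSomeRecord13PWS)
open Summit.QuantumFields.YangMills.BalabanUVNodes.K1BetaWindow13SOfNodes13PWSOfBoxH (nodes_leavesP_reletter_of_le)
open Summit.QuantumFields.YangMills.BalabanUVNodes.K1RunRowsOfBoxAndPartialSums (runRowsText_of_ceilingKeyedRung1_of_rows)
open Summit.QuantumFields.YangMills.Theorems.StabilityBAtRecordR13SepCoPH.Negative.SignBoxAtEveryWitnessFalse
  (withCeiling Rung1At rung1At_lowerβup nodes_leavesP_lowerβup)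

/-! ## §1. Re-lettering `(βup, γ) ↦ (c, γ')`, `γ' ≤ w.γ`: the twelve `βup`-free nodes transfer, N11 is the one bill -/

section Reletter

/-- **THE N11-ONLY RAISE.**  Nodes at `w` for the run `P` and N11 = `Dag.B14_main` at the re-lettered binding `{w with βup := c, γ := γ'}` (`γ' ≤ w.γ`, ANY ceiling letter `c`) ⟹ all
thirteen nodes at the re-lettered binding: the other twelve mains do not read `βup` and are antitone in `γ` (dag-n24-w1's `nodes_leavesP_reletter_of_le` at the floor `w.b`), N11 reads
[III] (2.6) with `β′ := βup` as an antecedent and does NOT transfer upward — it is the hypothesis `h14`.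
[cite: Balaban1989LargeFieldII, Introduction pp.355–356 (the citation DAG); Balaban1988Convergent, Thm 1 p.262, (2.6) p.255 (bookkeeping)] -/
theorem nodes_leavesP_reletter_ceiling (w : WorldP) {c γ' : ℝ} (hγ' : γ' ≤ w.γ) (P : B12.RunParams) (hn : Nodes (leavesP w P))
    (h14 : Dag.B14_main (leavesP { w with βup := c, γ := γ' } P)) : Nodes (leavesP { w with βup := c, γ := γ' } P) := by
  obtain ⟨h4, h5, h6, h7, h8, h9, h10, h11, h12, h13, -, h15, h16⟩ := nodes_leavesP_reletter_of_le w hγ' w.b_pos P hn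
  exact ⟨h4, h5, h6, h7, h8, h9, h10, h11, h12, h13, h14, h15, h16⟩

/-- The same for ALL runs at once. [cite: Balaban1989LargeFieldII, Introduction pp.355–356 (bookkeeping)] -/
theorem nodes_leavesP_reletter_ceiling_all (w : WorldP) {c γ' : ℝ} (hγ' : γ' ≤ w.γ) (hn : ∀ P : B12.RunParams, Nodes (leavesP w P))
    (h14 : ∀ P : B12.RunParams, Dag.B14_main (leavesP { w with βup := c, γ := γ' } P)) (P : B12.RunParams) :
    Nodes (leavesP { w with βup := c, γ := γ' } P) :=
  nodes_leavesP_reletter_ceiling w hγ' P (hn P) (h14 P)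

/-- **DOWNWARD (and same-window) re-lettering of N11 is FREE**: for `c ≤ w.βup`, N11 at `{w with βup := c, γ := w.γ}` from the nodes at `w` ([III] (2.6) with a smaller constant is
stronger; p602267 `nodes_leavesP_lowerβup`).  Only ceilings ABOVE the witness's letter cost an N11 re-proof. [cite: Balaban1988Convergent, (2.6) p.255 (bookkeeping)] -/
theorem b14_main_reletter_ceiling_of_le (w : WorldP) {c : ℝ} (hc : c ≤ w.βup) (P : B12.RunParams) (hn : Nodes (leavesP w P)) :
    Dag.B14_main (leavesP { w with βup := c, γ := w.γ } P) := by
  obtain ⟨-, -, -, -, -, -, -, -, -, -, h14, -, -⟩ := nodes_leavesP_lowerβup w hc P hn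
  exact h14

variable {F : T4Family}

/-- The S-bound record class `K1V6Defs.RecordS` does not read `βup` and accepts any smaller positive window. [cite: Balaban1989LargeFieldII, Thm 1 p.355 (bookkeeping)] -/
theorem recordS_reletter_ceiling {θ : Stage13HParams F 2} {h : θ.Provisos₁₃SepCoPH F 2} {w : WorldP} (hR : RecordS F θ h w) (c : ℝ) {γ' : ℝ}
    (hγ'0 : 0 < γ') (hγ' : γ' ≤ w.γ) : RecordS F θ h { w with βup := c, γ := γ' } := by
  obtain ⟨θ', h', hθ', hD, hC, hγ, hL, hup⟩ := hR
  exact ⟨θ', h', hθ', hD, hC, ⟨hγ'0, hγ'.trans hγ.2⟩, hL, hup⟩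

/-- p602267's rung-1 data `Rung1At` (core + `PrintedUV3V` + the [IV]-pin) pass to the re-lettered world given N11 there — neither extra conjunct reads `βup` or `γ`.
[cite: Balaban1989LargeFieldII, Thm 1 p.355; Balaban1985UV3, Thm 1 p.257; Balaban1989LargeFieldI, Prop. 1 p.194 (bookkeeping)] -/
theorem rung1At_reletter_ceiling {θ : Stage13HParams F 2} {h : θ.Provisos₁₃SepCoPH F 2} {w : WorldP} (hr : Rung1At F θ h w) (c : ℝ) {γ' : ℝ}
    (hγ'0 : 0 < γ') (hγ' : γ' ≤ w.γ) (h14 : ∀ P : B12.RunParams, Dag.B14_main (leavesP { w with βup := c, γ := γ' } P)) :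
    Rung1At F θ h { w with βup := c, γ := γ' } := by
  obtain ⟨hU, hθ, hR, hnodes, h08, lam, hsel, hpin⟩ := hr
  exact ⟨hU, hθ, recordS_reletter_ceiling (θ := θ) (h := h) hR c hγ'0 hγ', nodes_leavesP_reletter_ceiling_all w hγ' hnodes h14, h08, lam, hsel,
    fun P hP => hpin P hP⟩

end Reletter

/-! ## §2. ONE rung-1 core datum + N11 at every raised ceiling ⟹ the ceiling-keyed family ⟹ v6's rung-2″ text from MATCH-FREE rows (BY NAME) -/

section CeilingKeyed

variable {F : T4Family}

/-- **THE CEILING-KEYED RUNG-1 FAMILY FROM ONE WITNESS AND THE N11 RAISE.**  At ONE rung-1 core datum `(θ, h, w)` (`RecordS`, the thirteen nodes at every run): if N11 = `Dag.B14_main`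
holds at EVERY ceiling letter `c` after re-lettering the window to SOME `γ' ∈ ]0, w.γ]` ([III] Thm 1 p.262 with `β′` a parameter, `γ = γ(β′, β₀)`), then the ceiling-keyed family of
dag-n24-w1's bridge (p602861 §3, `hfam` with `RecordS` folded) is inhabited — the world is `{w with βup := c, γ := γ'}`.  CONDITIONAL on `hraise`; closes nothing.
[cite: Balaban1988Convergent, Thm 1 p.262, (2.6) p.255; Balaban1989LargeFieldII, Thm 1 p.355 (bookkeeping)] -/
theorem ceilingKeyedRung1_of_nodes_of_b14Raise (θ : Stage13HParams F 2) (h : θ.Provisos₁₃SepCoPH F 2) (w : WorldP) (hR : RecordS F θ h w)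
    (hnodes : ∀ P : B12.RunParams, Nodes (leavesP w P))
    (hraise : ∀ c : ℝ, ∃ γ' : ℝ, 0 < γ' ∧ γ' ≤ w.γ ∧ ∀ P : B12.RunParams, Dag.B14_main (leavesP { w with βup := c, γ := γ' } P)) :
    ∀ c : ℝ, ∃ w' : WorldP, c ≤ w'.βup ∧ RecordS F θ h w' ∧ ∀ P : B12.RunParams, Nodes (leavesP w' P) := fun c => by
  obtain ⟨γ', hγ'0, hγ', h14⟩ := hraise c
  exact ⟨{ w with βup := c, γ := γ' }, le_rfl, recordS_reletter_ceiling (θ := θ) (h := h) hR c hγ'0 hγ', nodes_leavesP_reletter_ceiling_all w hγ' hnodes h14⟩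

/-- **v6's RUNG-2″ TEXT `K1V6Defs.RunRowsAtSomeRecord13PWS F` FROM ONE RUNG-1 CORE DATUM, THE N11 RAISE THERE, AND THE MATCH-FREE RUN ROWS OF `β_θ`** (BY NAME through dag-n24-w1's
`runRowsText_of_ceilingKeyedRung1_of_rows`, p602861 §3: the world is chosen AFTER the rows, at `c := B + r`, so the match holds by the family's own clause).  The β-rows `b r γ₀ B M`
(run-wise constant remainder, `b ≤ B`, run-wise partial-sum floor `−M`) carry NO ceiling clause — [I] Thm 3 p.264 ∕ (5.10) p.293 shape.  CONDITIONAL; closes nothing.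
[cite: Balaban1987RG1, Thm 3 p.264, (1.20)–(1.22) p.264, (5.10) p.293; Balaban1988Convergent, Thm 1 p.262, (2.6) p.255; Balaban1989LargeFieldII, Thm 1 p.355 (bookkeeping)] -/
theorem runRowsAtSomeRecord13PWS_of_nodes_of_b14Raise_of_rowsWF (θ : Stage13HParams F 2) (h : θ.Provisos₁₃SepCoPH F 2) (w : WorldP)
    (hU : θ.ZhUnity F 2 ∧ θ.SlotsNondegenerate₁₃ F 2) (hθ : θ.Admissible F 2) (hR : RecordS F θ h w) (hnodes : ∀ P : B12.RunParams, Nodes (leavesP w P))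
    (hraise : ∀ c : ℝ, ∃ γ' : ℝ, 0 < γ' ∧ γ' ≤ w.γ ∧ ∀ P : B12.RunParams, Dag.B14_main (leavesP { w with βup := c, γ := γ' } P))
    {b : ℕ → ℝ} {r γ₀ B M : ℝ} (hγ₀ : 0 < γ₀) (hrem : RunConstRemainder (betaOfRecord₁₃ F 2 θ.toStage13Params) b r γ₀) (hB : ∀ k, b k ≤ B)
    (hps : ∀ (n : ℕ) (gs : ℕ → ℝ), RGEqH n (betaOfRecord₁₃ F 2 θ.toStage13Params) gs → Step.InInterval γ₀ n gs →
      ∀ k, k ≤ n → -M ≤ ∑ j ∈ Finset.Ico k n, betaOfRecord₁₃ F 2 θ.toStage13Params j (prefixOf gs j)) :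
    RunRowsAtSomeRecord13PWS F :=
  runRowsText_of_ceilingKeyedRung1_of_rows θ h hU hθ (ceilingKeyedRung1_of_nodes_of_b14Raise θ h w hR hnodes hraise) hγ₀ hrem hB hps

/-- **★ THE REGISTERED STUB 2″'s TEXT FROM TWO DISPLAYED SUPPLIERS** (CRIT-1 g4's `stub2V6_of_n11CU_stub2WF`, over the tree's `K1V6Defs` names, both suppliers def-free hypotheses):
`hN11` = «N11 CEILING-UNIFORM AT RUNG-1 CORE DATA» (nodes cell: at every `(θ, h, w)` with unity ∧ non-degeneracy, admissibility, `RecordS`, nodes at every run, and for EVERY ceiling letter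
`c`, SOME window `γ' ∈ ]0, w.γ]` with `Dag.B14_main` at `{w with βup := c, γ := γ'}` on every run — [III] Thm 1 with `β′` a parameter) and `hWF` = «v6's stub 2″ WITH THE MATCH CONJUNCT
DELETED» (β cell: from rung 1, SOME core datum with match-free run rows of `β_θ`).  Then `∀ F, NodesAtSomeRecord13PWS F → RunRowsAtSomeRecord13PWS F` — re-letter the β cell's world
AFTER its rows are known (`c := B + r`).  No skeleton change: the two suppliers land INSIDE the registered text.  CONDITIONAL on both; K1⁷ OPEN.
[cite: Balaban1988Convergent, Thm 1 p.262, (2.6)–(2.9) p.255; Balaban1987RG1, Thm 3 p.264, (5.10) p.293; Balaban1989LargeFieldII, Thm 1 p.355 (bookkeeping)] -/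
theorem stub_runRows13PWS_text_of_n11CeilingUniform_of_rowsWF
    (hN11 : ∀ (F : T4Family) (θ : Stage13HParams F 2) (h : θ.Provisos₁₃SepCoPH F 2) (w : WorldP),
      (θ.ZhUnity F 2 ∧ θ.SlotsNondegenerate₁₃ F 2) → θ.Admissible F 2 → RecordS F θ h w → (∀ P : B12.RunParams, Nodes (leavesP w P)) →
      ∀ c : ℝ, ∃ γ' : ℝ, 0 < γ' ∧ γ' ≤ w.γ ∧ ∀ P : B12.RunParams, Dag.B14_main (leavesP { w with βup := c, γ := γ' } P))
    (hWF : ∀ F : T4Family, NodesAtSomeRecord13PWS F →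
      ∃ (θ : Stage13HParams F 2) (h : θ.Provisos₁₃SepCoPH F 2) (w : WorldP), (θ.ZhUnity F 2 ∧ θ.SlotsNondegenerate₁₃ F 2) ∧ θ.Admissible F 2 ∧
        RecordS F θ h w ∧ (∀ P : B12.RunParams, Nodes (leavesP w P)) ∧
        ∃ (b : ℕ → ℝ) (r γ₀ B M : ℝ), 0 < γ₀ ∧ RunConstRemainder (betaOfRecord₁₃ F 2 θ.toStage13Params) b r γ₀ ∧ (∀ k, b k ≤ B) ∧
          ∀ (n : ℕ) (gs : ℕ → ℝ), RGEqH n (betaOfRecord₁₃ F 2 θ.toStage13Params) gs → Step.InInterval γ₀ n gs →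
            ∀ k, k ≤ n → -M ≤ ∑ j ∈ Finset.Ico k n, betaOfRecord₁₃ F 2 θ.toStage13Params j (prefixOf gs j)) :
    ∀ F : T4Family, NodesAtSomeRecord13PWS F → RunRowsAtSomeRecord13PWS F := fun F hF => by
  obtain ⟨θ, h, w, hU, hθ, hR, hnodes, b, r, γ₀, B, M, hγ₀, hrem, hB, hps⟩ := hWF F hF
  exact runRowsAtSomeRecord13PWS_of_nodes_of_b14Raise_of_rowsWF θ h w hU hθ hR hnodes (hN11 F θ h w hU hθ hR hnodes) hγ₀ hrem hB hps

/-- Sanity (the deleted conjunct is a weakening): v6's stub 2″ text implies the match-free supplier `hWF`'s text. [cite: Balaban1987RG1, Thm 3 p.264 (bookkeeping)] -/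
theorem rowsWF_text_of_stub_runRows13PWS_text (h₂ : ∀ F : T4Family, NodesAtSomeRecord13PWS F → RunRowsAtSomeRecord13PWS F) :
    ∀ F : T4Family, NodesAtSomeRecord13PWS F →
      ∃ (θ : Stage13HParams F 2) (h : θ.Provisos₁₃SepCoPH F 2) (w : WorldP), (θ.ZhUnity F 2 ∧ θ.SlotsNondegenerate₁₃ F 2) ∧ θ.Admissible F 2 ∧
        RecordS F θ h w ∧ (∀ P : B12.RunParams, Nodes (leavesP w P)) ∧
        ∃ (b : ℕ → ℝ) (r γ₀ B M : ℝ), 0 < γ₀ ∧ RunConstRemainder (betaOfRecord₁₃ F 2 θ.toStage13Params) b r γ₀ ∧ (∀ k, b k ≤ B) ∧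
          ∀ (n : ℕ) (gs : ℕ → ℝ), RGEqH n (betaOfRecord₁₃ F 2 θ.toStage13Params) gs → Step.InInterval γ₀ n gs →
            ∀ k, k ≤ n → -M ≤ ∑ j ∈ Finset.Ico k n, betaOfRecord₁₃ F 2 θ.toStage13Params j (prefixOf gs j) := fun F hF => by
  obtain ⟨θ, h, w, hU, hθ, hR, hnodes, b, r, γ₀, B, M, hγ₀, hrem, hB, -, hps⟩ := h₂ F hF
  exact ⟨θ, h, w, hU, hθ, hR, hnodes, b, r, γ₀, B, M, hγ₀, hrem, hB, hps⟩

/-- **K1⁷ BY NAME FROM THREE DISPLAYED TEXTS: stub 1's, «N11 ceiling-uniform at rung-1 core data», «match-free rows from rung 1»** (`K1V6Defs.stabilityBAtRecordR13SepCoPH_of_stubTexts` after ★).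
CONDITIONAL on all three; K1⁷ OPEN. [cite: Balaban1989LargeFieldII, Thm 1 p.355 + (0.1) pp.355–356; Balaban1988Convergent, Thm 1 p.262; Balaban1987RG1, Thm 3 p.264 (bookkeeping)] -/
theorem stabilityBAtRecordR13SepCoPH_of_stub1Text_of_n11CeilingUniform_of_rowsWF
    (h₁ : ∀ F : T4Family, K1V6Defs.Inhabited13 F → NodesAtSomeRecord13PWS F)
    (hN11 : ∀ (F : T4Family) (θ : Stage13HParams F 2) (h : θ.Provisos₁₃SepCoPH F 2) (w : WorldP),
      (θ.ZhUnity F 2 ∧ θ.SlotsNondegenerate₁₃ F 2) → θ.Admissible F 2 → RecordS F θ h w → (∀ P : B12.RunParams, Nodes (leavesP w P)) →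
      ∀ c : ℝ, ∃ γ' : ℝ, 0 < γ' ∧ γ' ≤ w.γ ∧ ∀ P : B12.RunParams, Dag.B14_main (leavesP { w with βup := c, γ := γ' } P))
    (hWF : ∀ F : T4Family, NodesAtSomeRecord13PWS F →
      ∃ (θ : Stage13HParams F 2) (h : θ.Provisos₁₃SepCoPH F 2) (w : WorldP), (θ.ZhUnity F 2 ∧ θ.SlotsNondegenerate₁₃ F 2) ∧ θ.Admissible F 2 ∧
        RecordS F θ h w ∧ (∀ P : B12.RunParams, Nodes (leavesP w P)) ∧
        ∃ (b : ℕ → ℝ) (r γ₀ B M : ℝ), 0 < γ₀ ∧ RunConstRemainder (betaOfRecord₁₃ F 2 θ.toStage13Params) b r γ₀ ∧ (∀ k, b k ≤ B) ∧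
          ∀ (n : ℕ) (gs : ℕ → ℝ), RGEqH n (betaOfRecord₁₃ F 2 θ.toStage13Params) gs → Step.InInterval γ₀ n gs →
            ∀ k, k ≤ n → -M ≤ ∑ j ∈ Finset.Ico k n, betaOfRecord₁₃ F 2 θ.toStage13Params j (prefixOf gs j)) :
    Summit.QuantumFields.YangMills.Theses.BalabanUVNodes.StabilityBAtRecordR13SepCoPH :=
  K1V6Defs.stabilityBAtRecordR13SepCoPH_of_stubTexts h₁ (stub_runRows13PWS_text_of_n11CeilingUniform_of_rowsWF hN11 hWF)

end CeilingKeyed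

/-! ## §3. Ceiling-blindness of stub 2″'s hypothesis (why the raise is unavoidable on this road) -/

section Blindness

variable (F : T4Family)

/-- v6's rung 1 `K1V6Defs.NodesAtSomeRecord13PWS F` IS «some rung-1 witness» in p602267's currency `Rung1At` (definitional). [cite: Balaban1989LargeFieldII, Thm 1 p.355 (bookkeeping)] -/
theorem nodesAtSomeRecord13PWS_iff_rung1At :
    NodesAtSomeRecord13PWS F ↔ ∃ (θ : Stage13HParams F 2) (h : θ.Provisos₁₃SepCoPH F 2) (w : WorldP), Rung1At F θ h w :=
  Iff.rfl

/-- **STUB 2″'s HYPOTHESIS DETERMINES NO LOWER BOUND ON THE INPUT CEILING.**  For EVERY real `c`: «some rung-1 witness» ↔ «some rung-1 witness with `w.βup ≤ c`» (twin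
`withCeiling w (min w.βup c)`, p602267 `rung1At_lowerβup`).  So the input world of `stub_runRows13PWS` may carry ANY ceiling letter while its output world must carry one `≥ B + r`
with the nodes — every proof re-worlds, i.e. contains N11 at a raised ceiling (§1: N11 is the only `βup`-reading main). [cite: Balaban1988Convergent, (2.6) p.255 (bookkeeping)] -/
theorem nodesAtSomeRecord13PWS_iff_belowCeiling (c : ℝ) :
    NodesAtSomeRecord13PWS F ↔ ∃ (θ : Stage13HParams F 2) (h : θ.Provisos₁₃SepCoPH F 2) (w : WorldP), w.βup ≤ c ∧ Rung1At F θ h w := by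
  refine ⟨fun ⟨θ, h, w, hr⟩ => ⟨θ, h, withCeiling w (min w.βup c), min_le_right _ _, rung1At_lowerβup F hr (min_le_left _ _)⟩,
    fun ⟨θ, h, w, _, hr⟩ => ⟨θ, h, w, hr⟩⟩

/-- In particular v6's stub 2″ text is EQUIVALENT to its restriction to inputs with ceiling letter `≤ -1`. [cite: Balaban1988Convergent, (2.6) p.255 (bookkeeping)] -/
theorem stub_runRows13PWS_text_iff_fromLowCeiling :
    (∀ F : T4Family, NodesAtSomeRecord13PWS F → RunRowsAtSomeRecord13PWS F) ↔
      ∀ F : T4Family, (∃ (θ : Stage13HParams F 2) (h : θ.Provisos₁₃SepCoPH F 2) (w : WorldP), w.βup ≤ -1 ∧ Rung1At F θ h w) →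
        RunRowsAtSomeRecord13PWS F :=
  ⟨fun h₂ F hF => h₂ F ((nodesAtSomeRecord13PWS_iff_belowCeiling F (-1)).2 hF),
    fun h₂ F hF => h₂ F ((nodesAtSomeRecord13PWS_iff_belowCeiling F (-1)).1 hF)⟩

/-- **THE DOWNWARD HALF OF THE N11 RAISE IS FREE at every rung-1 core datum**: for `c ≤ w.βup` take `γ' := w.γ` (`0 < w.γ` from `RecordS`). [cite: Balaban1988Convergent, (2.6) p.255 (bookkeeping)] -/
theorem b14Raise_below_free {θ : Stage13HParams F 2} {h : θ.Provisos₁₃SepCoPH F 2} {w : WorldP} (hR : RecordS F θ h w)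
    (hnodes : ∀ P : B12.RunParams, Nodes (leavesP w P)) {c : ℝ} (hle : c ≤ w.βup) :
    ∃ γ' : ℝ, 0 < γ' ∧ γ' ≤ w.γ ∧ ∀ P : B12.RunParams, Dag.B14_main (leavesP { w with βup := c, γ := γ' } P) := by
  obtain ⟨θ', h', -, -, -, hγ, -, -⟩ := hR
  exact ⟨w.γ, hγ.1, le_rfl, fun P => b14_main_reletter_ceiling_of_le w hle P (hnodes P)⟩

end Blindness


/-! ## §4  `N11CU`'s BODY ON N11's CHAIN ROAD: at any H-extension of a LIVE RE-PIN (e.g. K1's witness `θ₁₅ᶜᶜᴹᵂ(j; γ)`), from `∀ P, SupplyChainAt θ P` — the ceiling letter is never read -/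

section ChainRoad

open BalabanUVNodesN11Sect3SupplyChainObligationsDefs (SupplyChainAt)
open BalabanUVNodesN11Sect3SupplyChainNodeAtNumerics (b14_main_liveRepinH_of_obligations b14_main_theta13OfThm1CCMWH_of_obligations)

variable {F : T4Family}

/-- **★ `N11CU`'s BODY AT ANY RUNG-1 CORE DATUM OVER AN H-EXTENSION OF A LIVE RE-PIN, FROM N11's ONE-TOKEN RESIDUAL `∀ P, SupplyChainAt θ P`** (dag-n11-e g19 CONFIRM-(C): on the
chain road `Dag.B14_main (leavesP w P)` reads of the world ONLY `w.C = datum.C`, so the re-lettered binding `{w with βup := c, γ := w.γ}` costs what `w` costs — p606248 §1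
`b14_main_liveRepinH_of_obligations`; `RecordS` pins `w.C` to the datum, `rfl`).  For EVERY ceiling letter `c`, with `γ' := w.γ`.  CONDITIONAL on the residual ([III] §3's
`SupplierObligations` — nobody's theorem — and the no-expansion half, tree-discharged in the ZhPin class); N11 NOT discharged; K1⁷ NOT closed.
[cite: Balaban1988Convergent, Thm 1 p.262, Theorem p.245, §3 p.279, p.244 L36–38, (2.6) p.255; Balaban1989LargeFieldI, (0.3)–(0.4) p.176; Balaban1989LargeFieldII, Thm 1 p.355 (bookkeeping)] -/
theorem b14Raise_of_supplyChainAt_liveRepinH {θ₀ : Stage13Params F 2} {θ : Stage13HParams F 2} {h : θ.Provisos₁₃SepCoPH F 2} {w : WorldP}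
    (hθ : θ.toStage13Params = θ₀.liveRepin₁₃ F 2) (hθ₀ : θ₀.Admissible F 2) (hκ : 0 ≤ θ₀.s2.lf.κ) (hE₀ : 0 ≤ θ₀.s2.lf.E₀) (hB₀ : 0 ≤ θ₀.s2.lf.B₀) (hM : 1 ≤ θ₀.τ9.M)
    (hR : RecordS F θ h w) (hN : ∀ P : B12.RunParams, SupplyChainAt θ P) :
    ∀ c : ℝ, ∃ γ' : ℝ, 0 < γ' ∧ γ' ≤ w.γ ∧ ∀ P : B12.RunParams, Dag.B14_main (leavesP { w with βup := c, γ := γ' } P) := fun c => by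
  obtain ⟨θ', h', -, -, hC, hγ, -, -⟩ := hR
  refine ⟨w.γ, hγ.1, le_rfl, fun P => ?_⟩
  obtain ⟨σ, hσ, hT⟩ := hN P
  exact b14_main_liveRepinH_of_obligations hθ hθ₀ hκ hE₀ hB₀ hM h.toCore σ hσ hT { w with βup := c, γ := w.γ } hC

/-- **★★ `N11CU`'s BODY AT ANY RUNG-1 CORE DATUM OVER AN H-EXTENSION OF K1's WITNESS `θ₁₅ᶜᶜᴹᵂ(j; γ)`** (`θ.toStage13Params = theta13OfThm1CCMW F 2 j γ ε₀ ε₂₉ B₃ B₃' a₀ a₁`: the bare door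
`Stage13HParams.ofHistoryBlind …`, its Gaussian certificate `gaussPinH …`, dag-n11-d's `rePinH …`, all at `hθ := rfl`) FROM `∀ P, SupplyChainAt θ P` — window `0 < γ ≤ ½` + six signs
(p606248 §3 `b14_main_theta13OfThm1CCMWH_of_obligations`).  So on N11's chain road the `hN11` supplier of §2's ★ costs EXACTLY N11's own residual: the ceiling letter never enters,
MATCHʳ is dissolved for N11 by quantifier order (CRIT-1 §4; plan g83 (C)).  CONDITIONAL; N11 NOT discharged; K1⁷ NOT closed.
[cite: Balaban1988Convergent, Thm 1 p.262, Theorem p.245, §3 p.279, p.244 L36–38, (2.4)–(2.6) p.255; Balaban1987RG1, Thm 1 p.259; Balaban1989LargeFieldI, (0.3)–(0.4) p.176; Balaban1989LargeFieldII, Thm 1 p.355 (bookkeeping)] -/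
theorem b14Raise_of_supplyChainAt_theta13OfThm1CCMWH {j : ℕ} {γ ε₀ ε₂₉ B₃ B₃' a₀ a₁ : ℝ} {θ : Stage13HParams F 2} {h : θ.Provisos₁₃SepCoPH F 2} {w : WorldP}
    (hθ : θ.toStage13Params = theta13OfThm1CCMW F 2 j γ ε₀ ε₂₉ B₃ B₃' a₀ a₁) (hγ₀ : 0 < γ) (hγh : γ ≤ 1 / 2) (hε : 0 < ε₀) (hε' : 0 < ε₂₉) (hB : 0 ≤ B₃)
    (hB' : 0 ≤ B₃') (ha₀ : 0 < a₀) (ha₁ : 0 < a₁) (hR : RecordS F θ h w) (hN : ∀ P : B12.RunParams, SupplyChainAt θ P) :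
    ∀ c : ℝ, ∃ γ' : ℝ, 0 < γ' ∧ γ' ≤ w.γ ∧ ∀ P : B12.RunParams, Dag.B14_main (leavesP { w with βup := c, γ := γ' } P) := fun c => by
  obtain ⟨θ', h', -, -, hC, hγ, -, -⟩ := hR
  refine ⟨w.γ, hγ.1, le_rfl, fun P => ?_⟩
  obtain ⟨σ, hσ, hT⟩ := hN P
  exact b14_main_theta13OfThm1CCMWH_of_obligations hθ hγ₀ hγh hε hε' hB hB' ha₀ ha₁ h.toCore σ hσ hT { w with βup := c, γ := w.γ } hC

/-- **★★ v6's RUNG-2″ TEXT AT A RUNG-1 CORE DATUM OVER K1's WITNESS FROM N11's CHAIN + THE MATCH-FREE ROWS** (§2 fed by §4): `K1V6Defs.RunRowsAtSomeRecord13PWS F` from unity ∧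
non-degeneracy, admissibility, `RecordS`, the nodes at `w`, `∀ P, SupplyChainAt θ P` and the match-free run rows of `β_θ` — NO ceiling clause anywhere.  CONDITIONAL; K1⁷ NOT closed.
[cite: Balaban1987RG1, Thm 3 p.264, (1.20)–(1.22) p.264, (5.10) p.293; Balaban1988Convergent, Thm 1 p.262, §3 p.279, (2.6) p.255; Balaban1989LargeFieldII, Thm 1 p.355 (bookkeeping)] -/
theorem runRowsAtSomeRecord13PWS_of_supplyChainAt_theta13OfThm1CCMWH_of_rowsWF {j : ℕ} {γ ε₀ ε₂₉ B₃ B₃' a₀ a₁ : ℝ}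
    (θ : Stage13HParams F 2) (h : θ.Provisos₁₃SepCoPH F 2) (w : WorldP)
    (hθ : θ.toStage13Params = theta13OfThm1CCMW F 2 j γ ε₀ ε₂₉ B₃ B₃' a₀ a₁) (hγ₀ : 0 < γ) (hγh : γ ≤ 1 / 2) (hε : 0 < ε₀) (hε' : 0 < ε₂₉) (hB : 0 ≤ B₃)
    (hB' : 0 ≤ B₃') (ha₀ : 0 < a₀) (ha₁ : 0 < a₁)
    (hU : θ.ZhUnity F 2 ∧ θ.SlotsNondegenerate₁₃ F 2) (hθA : θ.Admissible F 2) (hR : RecordS F θ h w) (hnodes : ∀ P : B12.RunParams, Nodes (leavesP w P))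
    (hN : ∀ P : B12.RunParams, SupplyChainAt θ P)
    {b : ℕ → ℝ} {r γ₀ B M : ℝ} (hγ₀' : 0 < γ₀) (hrem : RunConstRemainder (betaOfRecord₁₃ F 2 θ.toStage13Params) b r γ₀) (hBb : ∀ k, b k ≤ B)
    (hps : ∀ (n : ℕ) (gs : ℕ → ℝ), RGEqH n (betaOfRecord₁₃ F 2 θ.toStage13Params) gs → Step.InInterval γ₀ n gs →
      ∀ k, k ≤ n → -M ≤ ∑ j ∈ Finset.Ico k n, betaOfRecord₁₃ F 2 θ.toStage13Params j (prefixOf gs j)) :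
    RunRowsAtSomeRecord13PWS F :=
  runRowsAtSomeRecord13PWS_of_nodes_of_b14Raise_of_rowsWF θ h w hU hθA hR hnodes
    (b14Raise_of_supplyChainAt_theta13OfThm1CCMWH (h := h) hθ hγ₀ hγh hε hε' hB hB' ha₀ ha₁ hR hN) hγ₀' hrem hBb hps

end ChainRoad

end Summit.QuantumFields.YangMills.Theorems.BalabanUVNodesK1RunRowsTextOfN11CUOfRowsWF

end
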